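import Literature.Analysis.FluidPDE.AlternatingSawtoothShearMixing
import HarnessLib

/-!
# Elgindi–Liss–Mattingly 2025: proved bookkeeping for the typed statements

Companion (theorems only, no definitions, no named facts) of `AlternatingSawtoothShearMixing.lean`
(T. M. Elgindi, K. Liss, J. C. Mattingly, Duke Math. J. 174 (2025) = arXiv:2304.05374v1,
[`ElgindiLissMattingly2025`]):

* the explicit shear maps are inverted by reversing time (`hFlow_neg_comp`, `vFlow_neg_comp`, …),
  whence `φ₁⁻¹ ∘ φ₁ = id = φ₁ ∘ φ₁⁻¹` (`periodInv_comp_periodMap`, `periodMap_comp_periodInv`),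
  `φ_t⁻¹ ∘ φ_t = id = φ_t ∘ φ_t⁻¹` (`flowInv_comp_flowMap`, `flowMap_comp_flowInv`) and the typed
  `flowInv α t` IS the inverse of the typed `flowMap α t` (`flowMap_bijective`);
* at integer times the inverse flow is the `n`-th iterate of `T = φ₁⁻¹`
  (`flowInv_natCast`, `flowMap_natCast`), the form in which (9)/(11) p. 7 and Liss–Mattingly's
  (2.2) use Theorem 2; hence Theorem 2 gives the discrete-time mixing estimate
  `|∫ (f ∘ T^[n]) g| ≤ C e^{-cn} ‖f‖_{C¹} ‖g‖_{C¹}` for mean-zero `f`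
  (`ElgindiLissMattingly2025_thm2.discrete`);
* `u_α` is time periodic with period one (`field_add_one`, `field_add_int`);
* the printed rate function `δ(ν) = c/|log ν|` of Theorem 1 satisfies Definition 1.1's requirement
  `ν/δ(ν) → 0` as `ν → 0⁺` (`tendsto_div_rate`);
* monotonicity of the decay clause in its constants (`DecaysAtRate.mono`).

## References

* T. M. Elgindi, K. Liss, J. C. Mattingly, arXiv:2304.05374v1: §1 pp. 2–4, (9)–(11) p. 7.
  [`ElgindiLissMattingly2025`]
* K. L. Liss, J. C. Mattingly, arXiv:2603.08904v1, (2.2) p. 4. [`LissMattingly2026`]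
-/

open MeasureTheory Set Filter Topology
open scoped ENNReal NNReal

noncomputable section

namespace Literature.Analysis.FluidPDE

namespace ElgindiLissMattingly2025

open FunctionSpaces

variable {α : ℝ}

/-! ## The shear maps: unchanged coordinates and inverses -/

/-- `hFlow` does not move the `y` coordinate. [cite: ElgindiLissMattingly2025, §1 (5) p. 3] -/
@[simp]
theorem hFlow_apply_one (α s : ℝ) (z : UnitAddTorus (Fin 2)) : hFlow α s z 1 = z 1 := by
  simp [hFlow]

/-- `vFlow` does not move the `x` coordinate. [cite: ElgindiLissMattingly2025, §1 (5) p. 3] -/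
@[simp]
theorem vFlow_apply_zero (α s : ℝ) (z : UnitAddTorus (Fin 2)) : vFlow α s z 0 = z 0 := by
  simp [vFlow]

/-- The sheared coordinate of `hFlow`. [cite: ElgindiLissMattingly2025, §1 (5) p. 3] -/
theorem hFlow_apply_zero (α s : ℝ) (z : UnitAddTorus (Fin 2)) :
    hFlow α s z 0 = z 0 + (((-2 * α * |Torus.repr z 1 - 1 / 2|) * s : ℝ) : UnitAddCircle) := by
  simp [hFlow]

/-- The sheared coordinate of `vFlow`. [cite: ElgindiLissMattingly2025, §1 (5) p. 3] -/
theorem vFlow_apply_one (α s : ℝ) (z : UnitAddTorus (Fin 2)) :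
    vFlow α s z 1 = z 1 + (((-2 * α * |Torus.repr z 0 - 1 / 2|) * s : ℝ) : UnitAddCircle) := by
  simp [vFlow]

/-- The profile seen by `hFlow` is unchanged by `hFlow`. [cite: ElgindiLissMattingly2025, §1 (5) p. 3] -/
theorem repr_hFlow_one (α s : ℝ) (z : UnitAddTorus (Fin 2)) :
    Torus.repr (hFlow α s z) 1 = Torus.repr z 1 := by
  rw [Torus.repr_apply, Torus.repr_apply, hFlow_apply_one]

/-- The profile seen by `vFlow` is unchanged by `vFlow`. [cite: ElgindiLissMattingly2025, §1 (5) p. 3] -/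
theorem repr_vFlow_zero (α s : ℝ) (z : UnitAddTorus (Fin 2)) :
    Torus.repr (vFlow α s z) 0 = Torus.repr z 0 := by
  rw [Torus.repr_apply, Torus.repr_apply, vFlow_apply_zero]

/-- Running `H_α` for time `s` and then for time `s'` is running it for time `s + s'`.
[cite: ElgindiLissMattingly2025, §1 (5) p. 3] -/
theorem hFlow_comp_hFlow (α s s' : ℝ) : hFlow α s' ∘ hFlow α s = hFlow α (s + s') := by
  funext z
  ext i
  fin_cases i
  · simp only [Function.comp_apply, Fin.zero_eta]
    rw [hFlow_apply_zero, hFlow_apply_zero, repr_hFlow_one, hFlow_apply_zero, add_assoc,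
      ← QuotientAddGroup.mk_add]
    congr 2
    push_cast
    ring
  · simp [Function.comp_apply]

/-- Running `V_α` for time `s` and then for time `s'` is running it for time `s + s'`.
[cite: ElgindiLissMattingly2025, §1 (5) p. 3] -/
theorem vFlow_comp_vFlow (α s s' : ℝ) : vFlow α s' ∘ vFlow α s = vFlow α (s + s') := by
  funext z
  ext i
  fin_cases i
  · simp [Function.comp_apply]
  · simp only [Function.comp_apply, Fin.mk_one]
    rw [vFlow_apply_one, vFlow_apply_one, repr_vFlow_zero, vFlow_apply_one, add_assoc,
      ← QuotientAddGroup.mk_add]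
    congr 2
    push_cast
    ring

/-- `hFlow α 0 = id`. [cite: ElgindiLissMattingly2025, §1 (5) p. 3] -/
@[simp]
theorem hFlow_zero (α : ℝ) : hFlow α 0 = id := by
  funext z
  ext i
  fin_cases i
  · simp [hFlow_apply_zero]
  · simp

/-- `vFlow α 0 = id`. [cite: ElgindiLissMattingly2025, §1 (5) p. 3] -/
@[simp]
theorem vFlow_zero (α : ℝ) : vFlow α 0 = id := by
  funext z
  ext i
  fin_cases i
  · simp
  · simp [vFlow_apply_one]

/-- Reversing time inverts the `H` shear: `hFlow α (-s) ∘ hFlow α s = id`.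
[cite: ElgindiLissMattingly2025, §1 (5)–(6) p. 3] -/
theorem hFlow_neg_comp (α s : ℝ) : hFlow α (-s) ∘ hFlow α s = id := by
  rw [hFlow_comp_hFlow, add_neg_cancel, hFlow_zero]

/-- … and `hFlow α s ∘ hFlow α (-s) = id`. [cite: ElgindiLissMattingly2025, §1 (5)–(6) p. 3] -/
theorem hFlow_comp_neg (α s : ℝ) : hFlow α s ∘ hFlow α (-s) = id := by
  rw [hFlow_comp_hFlow, neg_add_cancel, hFlow_zero]

/-- Reversing time inverts the `V` shear: `vFlow α (-s) ∘ vFlow α s = id`.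
[cite: ElgindiLissMattingly2025, §1 (5)–(6) p. 3] -/
theorem vFlow_neg_comp (α s : ℝ) : vFlow α (-s) ∘ vFlow α s = id := by
  rw [vFlow_comp_vFlow, add_neg_cancel, vFlow_zero]

/-- … and `vFlow α s ∘ vFlow α (-s) = id`. [cite: ElgindiLissMattingly2025, §1 (5)–(6) p. 3] -/
theorem vFlow_comp_neg (α s : ℝ) : vFlow α s ∘ vFlow α (-s) = id := by
  rw [vFlow_comp_vFlow, neg_add_cancel, vFlow_zero]

/-! ## The time-one map and its inverse -/

/-- `T ∘ φ₁ = id` (`T = φ₁⁻¹`, (9) p. 7). [cite: ElgindiLissMattingly2025, (9) p. 7] -/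
theorem periodInv_comp_periodMap (α : ℝ) : periodInv α ∘ periodMap α = id := by
  rw [periodInv, periodMap, Function.comp_assoc, ← Function.comp_assoc (hFlow α (-(1 / 2))),
    hFlow_neg_comp, Function.id_comp, vFlow_neg_comp]

/-- `φ₁ ∘ T = id`. [cite: ElgindiLissMattingly2025, (9) p. 7] -/
theorem periodMap_comp_periodInv (α : ℝ) : periodMap α ∘ periodInv α = id := by
  rw [periodInv, periodMap, Function.comp_assoc, ← Function.comp_assoc (vFlow α (1 / 2)),
    vFlow_comp_neg, Function.id_comp, hFlow_comp_neg]

/-- Iterates: `T^[n] ∘ φ₁^[n] = id`. [cite: ElgindiLissMattingly2025, (11) p. 7] -/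
theorem periodInv_iterate_comp (α : ℝ) (n : ℕ) :
    (periodInv α)^[n] ∘ (periodMap α)^[n] = id := by
  induction n with
  | zero => simp
  | succ n ih =>
    rw [Function.iterate_succ, Function.iterate_succ', Function.comp_assoc,
      ← Function.comp_assoc (periodInv α), periodInv_comp_periodMap, Function.id_comp, ih]

/-- Iterates: `φ₁^[n] ∘ T^[n] = id`. [cite: ElgindiLissMattingly2025, (11) p. 7] -/
theorem periodMap_iterate_comp (α : ℝ) (n : ℕ) :
    (periodMap α)^[n] ∘ (periodInv α)^[n] = id := by
  induction n with
  | zero => simp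
  | succ n ih =>
    rw [Function.iterate_succ, Function.iterate_succ', Function.comp_assoc,
      ← Function.comp_assoc (periodMap α), periodMap_comp_periodInv, Function.id_comp, ih]

/-! ## The within-period pieces and the full flow -/

/-- `withinPeriodInv α s ∘ withinPeriod α s = id` (every `s`).
[cite: ElgindiLissMattingly2025, §1 (5)–(6) p. 3] -/
theorem withinPeriodInv_comp_withinPeriod (α s : ℝ) :
    withinPeriodInv α s ∘ withinPeriod α s = id := by
  unfold withinPeriodInv withinPeriod
  split_ifs with h
  · exact vFlow_neg_comp α s
  · rw [Function.comp_assoc, ← Function.comp_assoc (hFlow α (-(s - 1 / 2))), hFlow_neg_comp,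
      Function.id_comp, vFlow_neg_comp]

/-- `withinPeriod α s ∘ withinPeriodInv α s = id` (every `s`).
[cite: ElgindiLissMattingly2025, §1 (5)–(6) p. 3] -/
theorem withinPeriod_comp_withinPeriodInv (α s : ℝ) :
    withinPeriod α s ∘ withinPeriodInv α s = id := by
  unfold withinPeriodInv withinPeriod
  split_ifs with h
  · exact vFlow_comp_neg α s
  · rw [Function.comp_assoc, ← Function.comp_assoc (vFlow α (1 / 2)), vFlow_comp_neg,
      Function.id_comp, hFlow_comp_neg]

/-- At time `0` within a period nothing has moved. [cite: ElgindiLissMattingly2025, §1 (5) p. 3] -/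
@[simp]
theorem withinPeriod_zero (α : ℝ) : withinPeriod α 0 = id := by
  simp [withinPeriod]

/-- The inverse within-period map at time `0` is the identity.
[cite: ElgindiLissMattingly2025, §1 (6) p. 3] -/
@[simp]
theorem withinPeriodInv_zero (α : ℝ) : withinPeriodInv α 0 = id := by
  simp [withinPeriodInv]

/-- **`φ_t⁻¹ ∘ φ_t = id`**: the typed `flowInv` inverts the typed `flowMap` (every `t`).
[cite: ElgindiLissMattingly2025, §1 (5)–(6) p. 3] -/
theorem flowInv_comp_flowMap (α t : ℝ) : flowInv α t ∘ flowMap α t = id := by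
  rw [flowInv, flowMap, Function.comp_assoc, ← Function.comp_assoc (withinPeriodInv α _),
    withinPeriodInv_comp_withinPeriod, Function.id_comp, periodInv_iterate_comp]

/-- **`φ_t ∘ φ_t⁻¹ = id`**. [cite: ElgindiLissMattingly2025, §1 (5)–(6) p. 3] -/
theorem flowMap_comp_flowInv (α t : ℝ) : flowMap α t ∘ flowInv α t = id := by
  rw [flowInv, flowMap, Function.comp_assoc, ← Function.comp_assoc ((periodMap α)^[_]),
    periodMap_iterate_comp, Function.id_comp, withinPeriod_comp_withinPeriodInv]

/-- `φ_t` is a bijection of `𝕋²` with inverse `φ_t⁻¹ = flowInv α t` ("a measure-preserving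
homeomorphism", p. 3; bijectivity is what is proved here). [cite: ElgindiLissMattingly2025, §1 (5) p. 3] -/
theorem flowMap_bijective (α t : ℝ) : Function.Bijective (flowMap α t) :=
  ⟨Function.LeftInverse.injective (congrFun (flowInv_comp_flowMap α t)),
    Function.RightInverse.surjective (congrFun (flowMap_comp_flowInv α t))⟩

/-- `φ_t⁻¹` is a bijection. [cite: ElgindiLissMattingly2025, §1 (6) p. 3] -/
theorem flowInv_bijective (α t : ℝ) : Function.Bijective (flowInv α t) :=
  ⟨Function.LeftInverse.injective (congrFun (flowMap_comp_flowInv α t)),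
    Function.RightInverse.surjective (congrFun (flowInv_comp_flowMap α t))⟩

/-- `φ₀ = id`. [cite: ElgindiLissMattingly2025, §1 (5) p. 3 (φ₀(z) = z)] -/
@[simp]
theorem flowMap_zero (α : ℝ) : flowMap α 0 = id := by
  simp [flowMap]

/-- `φ₀⁻¹ = id`. [cite: ElgindiLissMattingly2025, §1 (5)–(6) p. 3] -/
@[simp]
theorem flowInv_zero (α : ℝ) : flowInv α 0 = id := by
  simp [flowInv]

/-- **At integer times `φ_n⁻¹ = T^[n]`**, `T = φ₁⁻¹` — the iterates of (11) p. 7 and the maps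
`T_α^{-n}` of Liss–Mattingly's (2.2). [cite: ElgindiLissMattingly2025, (9) and (11) p. 7] -/
theorem flowInv_natCast (α : ℝ) (n : ℕ) : flowInv α n = (periodInv α)^[n] := by
  simp [flowInv]

/-- At integer times `φ_n = φ₁^[n]`. [cite: ElgindiLissMattingly2025, §1 (5) p. 3] -/
theorem flowMap_natCast (α : ℝ) (n : ℕ) : flowMap α n = (periodMap α)^[n] := by
  simp [flowMap]

/-- In particular `φ₁⁻¹ = T`. [cite: ElgindiLissMattingly2025, (9) p. 7] -/
@[simp]
theorem flowInv_one (α : ℝ) : flowInv α 1 = periodInv α := by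
  simpa using flowInv_natCast α 1

/-- … and `φ₁ = periodMap α`. [cite: ElgindiLissMattingly2025, §1 (5) p. 3] -/
@[simp]
theorem flowMap_one (α : ℝ) : flowMap α 1 = periodMap α := by
  simpa using flowMap_natCast α 1

/-! ## Time periodicity of `u_α` -/

/-- `u_α(t + 1) = u_α(t)`: the field is time periodic with period one.
[cite: ElgindiLissMattingly2025, §1 p. 2 ("extended for t ≥ 1 to be time periodic with a period of one")] -/
theorem field_add_one (α t : ℝ) : field α (t + 1) = field α t := by
  funext z
  simp [field, Int.fract_add_one]

/-- `u_α(t + m) = u_α(t)` for every integer `m`. [cite: ElgindiLissMattingly2025, §1 p. 2] -/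
theorem field_add_int (α t : ℝ) (m : ℤ) : field α (t + m) = field α t := by
  funext z
  simp [field, Int.fract_add_intCast]

/-- `u_α` is `Function.Periodic` in time with period `1`. [cite: ElgindiLissMattingly2025, §1 p. 2] -/
theorem field_periodic (α : ℝ) : Function.Periodic (field α) 1 :=
  fun t => field_add_one α t

/-- On the first half period the field is `V_α`. [cite: ElgindiLissMattingly2025, §1 p. 2 (u_α = V_α on [0,1/2))] -/
theorem field_of_mem_Ico_left {t : ℝ} (ht : t ∈ Ico (0 : ℝ) (1 / 2)) (α : ℝ) :
    field α t = fieldV α := by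
  funext z
  have hf : Int.fract t = t := Int.fract_eq_self.2 ⟨ht.1, by linarith [ht.2]⟩
  unfold field
  rw [hf, if_pos ht.2]

/-- On the second half period the field is `H_α`. [cite: ElgindiLissMattingly2025, §1 p. 2 (u_α = H_α on [1/2,1))] -/
theorem field_of_mem_Ico_right {t : ℝ} (ht : t ∈ Ico (1 / 2 : ℝ) 1) (α : ℝ) :
    field α t = fieldH α := by
  funext z
  have hf : Int.fract t = t := Int.fract_eq_self.2 ⟨by linarith [ht.1], ht.2⟩
  unfold field
  rw [hf, if_neg (not_lt.2 ht.1)]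

/-! ## The rate function of Theorem 1 meets Definition 1.1's limit requirement -/

/-- For the printed optimal rate `δ(ν) = c/|log ν|` (`c > 0`), `ν/δ(ν) = ν|log ν|/c → 0` as
`ν → 0⁺` — the condition `lim_{ν→0} ν/δ(ν) = 0` of Definition 1.1.
[cite: ElgindiLissMattingly2025, Def. 1.1 p. 2 and Thm. 1 p. 3] -/
theorem tendsto_div_rate {c : ℝ} (hc : 0 < c) :
    Tendsto (fun ν : ℝ => ν / (c / |Real.log ν|)) (𝓝[>] 0) (𝓝 0) := by
  have h1 : Tendsto (fun ν : ℝ => Real.log ν * ν ^ (1 : ℝ)) (𝓝[>] 0) (𝓝 0) :=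
    tendsto_log_mul_rpow_nhdsGT_zero zero_lt_one
  have h2 : Tendsto (fun ν : ℝ => |Real.log ν * ν ^ (1 : ℝ)| / c) (𝓝[>] 0) (𝓝 0) := by
    simpa using (h1.abs).div_const c
  refine h2.congr' ?_
  filter_upwards [self_mem_nhdsWithin] with ν (hν : 0 < ν)
  rw [Real.rpow_one, abs_mul, abs_of_pos hν]
  field_simp

/-- The rate `c/|log ν|` is positive for `ν ∈ (0, 1/2]` and `c > 0` (`log ν ≠ 0` there).
[cite: ElgindiLissMattingly2025, Thm. 1 p. 3] -/
theorem rate_pos {c ν : ℝ} (hc : 0 < c) (hν : ν ∈ Ioc (0 : ℝ) (1 / 2)) :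
    0 < c / |Real.log ν| := by
  have hlog : Real.log ν < 0 := Real.log_neg hν.1 (by linarith [hν.2])
  exact div_pos hc (abs_pos.2 hlog.ne)

/-! ## Monotonicity of the decay clause in its constants -/

/-- A decay bound with constant `C ≥ 0` and rate `r` implies the bound with any larger constant
and any smaller rate. [cite: ElgindiLissMattingly2025, Def. 1.1 p. 2] -/
theorem DecaysAtRate.mono {ν : ℝ} {u : ℝ → UnitAddTorus (Fin 2) → EuclideanSpace ℝ (Fin 2)}
    {r r' C C' : ℝ} (h : DecaysAtRate ν u r C) (hC : 0 ≤ C) (hCC' : C ≤ C') (hrr' : r' ≤ r) :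
    DecaysAtRate ν u r' C' := by
  intro f₀ hf₀ T θ hT hθ hc t ht
  refine (h f₀ hf₀ T θ hT hθ hc t ht).trans (mul_le_mul_of_nonneg_right ?_ ?_)
  · have h0 : 0 ≤ C * Real.exp (-(r * t)) := mul_nonneg hC (Real.exp_pos _).le
    have h1 : C * Real.exp (-(r * t)) ≤ C' * Real.exp (-(r' * t)) :=
      mul_le_mul hCC' (Real.exp_le_exp.2 (by nlinarith [ht.1])) (Real.exp_pos _).le
        (hC.trans hCC')
    exact pow_le_pow_left₀ h0 h1 2
  · unfold Torus.scalarL2Sq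
    exact integral_nonneg fun _ => by positivity

end ElgindiLissMattingly2025

open FunctionSpaces ElgindiLissMattingly2025

/-- **Theorem 2 in discrete time** (the form (11) p. 7 / Liss–Mattingly (2.2)): for every
sufficiently large even integer `α` there are `C, c > 0` with
`|∫ (f ∘ T^[n]) g| ≤ C e^{-cn} ‖f‖_{C¹} ‖g‖_{C¹}` for all `n ∈ ℕ` and all `f, g ∈ C¹(𝕋²)` with
`∫ f = 0`, `T = φ₁⁻¹ = periodInv α` — Theorem 2 at the integer times `t = n`, where
`φ_n⁻¹ = T^[n]` (`flowInv_natCast`). [cite: ElgindiLissMattingly2025, Thm. 2 p. 4 and (9), (11) p. 7] -/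
theorem ElgindiLissMattingly2025_thm2.discrete (h : ElgindiLissMattingly2025_thm2) :
    ∃ α₀ : ℕ, ∀ α : ℕ, α₀ ≤ α → Even α →
      ∃ C c : ℝ, 0 < C ∧ 0 < c ∧ ∀ n : ℕ, ∀ f g : UnitAddTorus (Fin 2) → ℝ,
        Torus.IsContDiff 1 f → Torus.IsContDiff 1 g → ∫ z, f z = 0 →
          |∫ z, f ((periodInv (α : ℝ))^[n] z) * g z| ≤
            C * Real.exp (-(c * n)) * (eBoundedHolderNorm 1 f).toReal *
              (eBoundedHolderNorm 1 g).toReal := by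
  obtain ⟨α₀, hα⟩ := h
  refine ⟨α₀, fun α hαα heven => ?_⟩
  obtain ⟨C, c, hC, hc, hmix⟩ := hα α hαα heven
  refine ⟨C, c, hC, hc, fun n f g hf hg hf0 => ?_⟩
  have h1 := hmix n (Nat.cast_nonneg n) f g hf hg
  rw [flowInv_natCast, hf0, zero_mul, sub_zero] at h1
  exact h1

end Literature.Analysis.FluidPDE

end
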